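import Mathlib
import Summits.Ventures.HodgeRepro.BallGen

/-!
# Transitivity of `U(p,1)` on `𝔹^p`: the boosts

Blind re-derivation cell `pub-hodge-repro`, seat `typer-2` (gen 3).  For `a ∈ 𝔹^p` put `s = √(1 − |a|²) > 0`,
`P = a aᴴ` and `A = −s·1 − P/(1+s)`; the matrix `g_a = [[A, a], [−aᴴ, 1]]` satisfies `g_aᴴ J g_a = s² J`
(block algebra, `g_rel`), so `T_a := g_a / s ∈ U(p,1)`, and `T_a · 0 = a` (`act_boost_center`): the group acts
TRANSITIVELY on the ball (`exists_act_center_eq`).  This is the automorphism `φ_a` of Rudin, *Function Theory in the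
Unit Ball of ℂⁿ*, §2.2.1 (up to the sign convention), written in homogeneous coordinates.
-/

set_option autoImplicit false

noncomputable section

namespace HodgeRepro.BallGen

open Matrix Complex ComplexConjugate

variable {p : ℕ}

/-- The centre `0 ∈ 𝔹^p`. -/
def center (p : ℕ) : Ball p := ⟨0, by simp [nsq]⟩

/-- `lift (center p) = (0, 1)`. -/
theorem lift_center : lift (center p) = Sum.elim (0 : Fin p → ℂ) fun _ => 1 := rfl

/-- `star a ⬝ᵥ a = Σ |a_i|²`. -/
theorem star_dotProduct_self (a : Fin p → ℂ) : star a ⬝ᵥ a = ((nsq a : ℝ) : ℂ) := by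
  simp only [dotProduct, Pi.star_apply, Complex.star_def, Complex.conj_mul', nsq]
  push_cast
  rfl

section Boost

variable (a : Ball p)

/-- `s = √(1 − |a|²)`. -/
def s : ℝ := Real.sqrt (1 - nsq a.1)

/-- `s > 0` on the ball. -/
theorem s_pos : 0 < s a := Real.sqrt_pos.2 (by have := a.2; linarith)

/-- `s² = 1 − |a|²`. -/
theorem s_sq : s a ^ 2 = 1 - nsq a.1 := Real.sq_sqrt (by have := a.2; linarith)

/-- `s ≠ 0`. -/
theorem s_ne_zero : s a ≠ 0 := (s_pos a).ne'

/-- `1 + s ≠ 0`. -/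
theorem one_add_s_ne_zero : (1 + s a : ℝ) ≠ 0 := by have := s_pos a; linarith

/-- `P = a aᴴ`. -/
def P : Matrix (Fin p) (Fin p) ℂ := vecMulVec a.1 (star a.1)

/-- `P` is Hermitian. -/
theorem P_conjTranspose : (P a)ᴴ = P a := by
  simp [P, conjTranspose_vecMulVec]

/-- `P * P = (1 − s²) • P`. -/
theorem P_mul_P : P a * P a = ((1 - s a ^ 2 : ℝ) : ℂ) • P a := by
  rw [P, vecMulVec_mul_vecMulVec, vecMulVec_smul, star_dotProduct_self, s_sq]
  push_cast; ring_nf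

/-- `P a = (1 − s²) • a`. -/
theorem P_mulVec : P a *ᵥ a.1 = ((1 - s a ^ 2 : ℝ) : ℂ) • a.1 := by
  rw [P, vecMulVec_mulVec, op_smul_eq_smul, star_dotProduct_self, s_sq]
  push_cast; ring_nf

/-- `A = −s·1 − P/(1+s)`. -/
def A : Matrix (Fin p) (Fin p) ℂ := (-(s a : ℂ)) • (1 : Matrix (Fin p) (Fin p) ℂ) - ((1 + s a : ℝ) : ℂ)⁻¹ • P a

/-- `A` is Hermitian. -/
theorem A_conjTranspose : (A a)ᴴ = A a := by
  simp only [A, conjTranspose_sub, conjTranspose_smul, conjTranspose_one, P_conjTranspose, Complex.star_def,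
    map_neg, Complex.conj_ofReal, map_inv₀]

/-- `A a = −a`. -/
theorem A_mulVec : A a *ᵥ a.1 = -a.1 := by
  have h1 : (1 + s a : ℝ) ≠ 0 := one_add_s_ne_zero a
  simp only [A, sub_mulVec, smul_mulVec, one_mulVec, P_mulVec, smul_smul]
  have : ((1 + s a : ℝ) : ℂ)⁻¹ * ((1 - s a ^ 2 : ℝ) : ℂ) = 1 - (s a : ℂ) := by
    have h1' : ((1 + s a : ℝ) : ℂ) ≠ 0 := by exact_mod_cast h1
    field_simp
    push_cast; ring
  rw [this]
  ext i; simp [Pi.smul_apply]; ring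

/-- `A * A = s² • 1 + P`. -/
theorem A_mul_A : A a * A a = ((s a ^ 2 : ℝ) : ℂ) • (1 : Matrix (Fin p) (Fin p) ℂ) + P a := by
  have h1 : ((1 + s a : ℝ) : ℂ) ≠ 0 := by exact_mod_cast one_add_s_ne_zero a
  simp only [A, sub_mul, mul_sub, smul_mul_assoc, mul_smul_comm, one_mul, mul_one, P_mul_P, smul_smul]
  have h1' : (1 + (s a : ℂ)) ≠ 0 := by exact_mod_cast one_add_s_ne_zero a
  match_scalars
  · ring
  · field_simp
    ring

/-- The unnormalised boost `g_a = [[A, a], [−aᴴ, 1]]`. -/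
def g : Matrix (Idx p) (Idx p) ℂ :=
  fromBlocks (A a) (replicateCol Unit a.1) (replicateRow Unit (-star a.1)) 1

/-- `g_aᴴ J g_a = s² J`. -/
theorem g_rel : (g a)ᴴ * J p * g a = ((s a ^ 2 : ℝ) : ℂ) • J p := by
  have hA : star a.1 ᵥ* A a = -star a.1 := by
    rw [← A_conjTranspose, vecMul_conjTranspose, star_star, A_mulVec, star_neg]
  rw [g, J_eq_fromBlocks, fromBlocks_conjTranspose, fromBlocks_multiply, fromBlocks_multiply, fromBlocks_smul,
    A_conjTranspose, conjTranspose_replicateCol, conjTranspose_replicateRow, conjTranspose_one, star_neg, star_star]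
  simp only [Matrix.mul_one, Matrix.mul_zero, zero_add, add_zero, Matrix.mul_neg, Matrix.neg_mul, Matrix.one_mul,
    smul_neg, smul_zero]
  have hCR : replicateCol Unit (-a.1) * replicateRow Unit (-star a.1) = P a := by
    rw [← vecMulVec_eq]; ext i j; simp [vecMulVec_apply, P]
  congr 1
  · rw [A_mul_A, hCR]; abel
  · rw [← replicateCol_mulVec, A_mulVec, add_neg_cancel]
  · rw [← replicateRow_vecMul, hA, add_neg_cancel]
  · rw [replicateRow_mul_replicateCol, star_dotProduct_self]
    ext i j
    simp only [Matrix.add_apply, Matrix.of_apply, Matrix.neg_apply, Matrix.one_apply, Matrix.smul_apply,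
      Subsingleton.elim i j, if_true, smul_eq_mul, mul_one]
    rw [show ((s a ^ 2 : ℝ) : ℂ) = 1 - (nsq a.1 : ℂ) by rw [s_sq]; push_cast; ring]
    ring

/-- The normalised boost satisfies the defining relation of `U(p,1)`. -/
theorem boost_rel :
    ((((s a)⁻¹ : ℝ) : ℂ) • g a)ᴴ * J p * ((((s a)⁻¹ : ℝ) : ℂ) • g a) = J p := by
  rw [conjTranspose_smul, Matrix.smul_mul, Matrix.mul_smul, Matrix.smul_mul, g_rel, smul_smul, smul_smul]
  have hs : (s a : ℂ) ≠ 0 := by exact_mod_cast s_ne_zero a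
  have : (((s a)⁻¹ : ℝ) : ℂ) * star ((((s a)⁻¹ : ℝ) : ℂ)) * ((s a ^ 2 : ℝ) : ℂ) = 1 := by
    rw [Complex.star_def, Complex.conj_ofReal]
    push_cast
    field_simp
  rw [this, one_smul]

/-- **The boost** `T_a = g_a / s ∈ U(p,1)`. -/
def boost : U p := mkU _ (boost_rel a)

/-- The matrix of the boost. -/
@[simp] theorem mat_boost : mat (boost a) = (((s a)⁻¹ : ℝ) : ℂ) • g a := rfl

/-- `g_a · (0, 1) = (a, 1)`. -/
theorem g_mulVec_lift_center : g a *ᵥ lift (center p) = lift a := by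
  rw [lift_center, g, fromBlocks_mulVec]
  ext i
  rcases i with i | i
  · simp [mulVec, dotProduct, replicateCol_apply, lift]
  · simp [lift]

/-- `T_a · (0, 1) = s⁻¹ · (a, 1)`. -/
theorem W_boost_center : W (boost a) (center p) = (((s a)⁻¹ : ℝ) : ℂ) • lift a := by
  unfold W; rw [mat_boost, smul_mulVec, g_mulVec_lift_center]

/-- **Transitivity**: the boost moves the centre to `a`: `T_a · 0 = a`. -/
theorem act_boost_center : act (boost a) (center p) = a := by
  have hc : (((s a)⁻¹ : ℝ) : ℂ) ≠ 0 := by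
    have := s_ne_zero a; exact_mod_cast inv_ne_zero this
  have hQ : Q ((((s a)⁻¹ : ℝ) : ℂ) • lift a) < 0 := by rw [← W_boost_center]; exact Q_W _ _
  calc act (boost a) (center p) = proj (W (boost a) (center p)) (Q_W _ _) := rfl
    _ = proj ((((s a)⁻¹ : ℝ) : ℂ) • lift a) hQ := proj_congr (W_boost_center a) _ _
    _ = proj (lift a) (Q_lift a) := proj_smul _ _ _ hc _
    _ = a := by
        apply Subtype.ext
        ext i
        simp [proj, lift]

end Boost

/-- `U(p,1)` acts transitively on `𝔹^p`: every point is the image of the centre. -/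
theorem exists_act_center_eq (a : Ball p) : ∃ g : U p, act g (center p) = a :=
  ⟨boost a, act_boost_center a⟩

/-- Every pair of points is related by the group. -/
theorem exists_act_eq (z w : Ball p) : ∃ g : U p, act g z = w :=
  ⟨boost w * (boost z)⁻¹, by
    have hz : act (boost z)⁻¹ z = center p := by
      have h := act_inv_act (boost z) (center p)
      rwa [act_boost_center] at h
    rw [← act_mul, hz, act_boost_center]⟩

end HodgeRepro.BallGen

end
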